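import Mathlib

/-!
# LINE L13 «DBR POLYNOMIAL DOOR» — node 2 (Laguerre direction): real-rooted `p` has `E_p` zero-free on `ℂ₊`

Cell rh-split, route `DeBrangesSuzukiDoor`, item `stmt-RiemannHypothesis-21497` (`PolyDoorLaguerre`, registrar
rh-split-dbr-neg g16, skeleton `LineDbrB0.lean`).  Let `p ≠ 0` be a real polynomial all of whose complex roots are
real, `P = p.map (algebraMap ℝ ℂ)`, and `Im z > 0`.  Then `P(z) ≠ 0`, and the logarithmic derivative
`P′(z) = P(z) · Σ_{a ∈ roots P} 1/(z − a)` (Mathlib `Polynomial.Splits.eval_derivative_eq_eval_mul_sum`) gives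
`E_p(z) = P(z) + i P′(z) = P(z) · (1 + i S)`, `S = Σ 1/(z − a)`.  Every root `a` is real, so
`Im (1/(z − a)) = −Im z/|z − a|² ≤ 0`, hence `Re (1 + i S) = 1 − Im S ≥ 1` and `E_p(z) ≠ 0`.

Proved BY VALUE (the item's `payload.signature` verbatim; the route file does not yet declare the decl).
Classical (Laguerre / Hermite–Biehler for `(p, p′)`: Levin 1964 ch. VII; arXiv:math/0607640 Thm 3.6);
E-GENERAL, RH-free, Mathlib only.
HONEST LABEL: known mathematics, RECORD line, 0 summit credit; nothing here bears on the truth of RH.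
-/

set_option linter.dupNamespace false

namespace Summit.RiemannHypothesis.RiemannHypothesis.Theorems.Splittings.PolyDoorLaguerre

open Polynomial

/-- For `Im z > 0` and a multiset of real points `s`, `Im Σ_{a ∈ s} 1/(z − a) ≤ 0`
(each term has imaginary part `−Im z/|z − a|²`). [folklore] -/
theorem im_sum_one_div_sub_nonpos {z : ℂ} (hz : 0 < z.im) :
    ∀ s : Multiset ℂ, (∀ a ∈ s, a.im = 0) → ((s.map fun a => 1 / (z - a)).sum).im ≤ 0 := by
  intro s
  induction s using Multiset.induction_on with
  | empty => intro; simp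
  | cons b s ih =>
    intro h
    rw [Multiset.map_cons, Multiset.sum_cons, Complex.add_im]
    have hb : b.im = 0 := h b (Multiset.mem_cons_self b s)
    have ih' := ih (fun a ha => h a (Multiset.mem_cons_of_mem ha))
    have h1 : (1 / (z - b)).im ≤ 0 := by
      rw [one_div, Complex.inv_im, Complex.sub_im, hb, sub_zero]
      exact div_nonpos_of_nonpos_of_nonneg (neg_nonpos.2 hz.le) (Complex.normSq_nonneg _)
    linarith

/-- **Node 2 of LINE L13 (item `stmt-RiemannHypothesis-21497`, `PolyDoorLaguerre` by value).**
If every complex root of the real polynomial `p ≠ 0` is real, then `E_p = p_ℂ + i p_ℂ′` has no zero in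
the open upper half-plane. [folklore] (Laguerre / Hermite–Biehler for `(p, p′)`; Levin, *Distribution of zeros
of entire functions*, ch. VII.) -/
theorem polyDoorLaguerre :
    ∀ p : Polynomial ℝ, p ≠ 0 → (∀ z : ℂ, (p.map (algebraMap ℝ ℂ)).eval z = 0 → z.im = 0) →
      ∀ z : ℂ, 0 < z.im → (p.map (algebraMap ℝ ℂ) + Polynomial.C Complex.I *
        Polynomial.derivative (p.map (algebraMap ℝ ℂ))).eval z ≠ 0 := by
  intro p hp hreal z hz
  have hP0 : p.map (algebraMap ℝ ℂ) ≠ 0 :=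
    (Polynomial.map_ne_zero_iff (algebraMap ℝ ℂ).injective).2 hp
  have hPz : (p.map (algebraMap ℝ ℂ)).eval z ≠ 0 := fun h => hz.ne' (hreal z h)
  have hS : (p.map (algebraMap ℝ ℂ)).Splits := IsAlgClosed.splits _
  have hroots : ∀ a ∈ (p.map (algebraMap ℝ ℂ)).roots, a.im = 0 :=
    fun a ha => hreal a ((Polynomial.mem_roots hP0).1 ha)
  rw [eval_add, eval_mul, eval_C, hS.eval_derivative_eq_eval_mul_sum hPz, ← mul_assoc,
    mul_comm Complex.I, mul_assoc, ← mul_one_add]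
  refine mul_ne_zero hPz ?_
  intro h0
  have hre := congrArg Complex.re h0
  simp only [Complex.add_re, Complex.one_re, Complex.mul_re, Complex.I_re, zero_mul, Complex.I_im,
    one_mul, zero_sub, Complex.zero_re] at hre
  have hle := im_sum_one_div_sub_nonpos hz _ hroots
  linarith

end Summit.RiemannHypothesis.RiemannHypothesis.Theorems.Splittings.PolyDoorLaguerre
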